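import Summits.BirchSwinnertonDyer.BirchSwinnertonDyer.Theorems.PrintCf2DisegniPairTwoDisegniGZPair
import Summits.BirchSwinnertonDyer.BirchSwinnertonDyer.Theorems.PrintCf2DisegniPairTwoCanonicalCycPin
import Literature.NumberTheory.EllipticCurves.Disegni2017.ChiLineTheoremBPinAtProofs
import Literature.NumberTheory.EllipticCurves.CanonicalPAdicHeightParallelogramProofs
import Literature.NumberTheory.EllipticCurves.CanonicalPAdicHeightThetaProofs
import HarnessLib

/-!
# Road (C) `disegni-pair-two` on crux stmt-BirchSwinnertonDyer-20368 — THE ENTRY TICKET ON NINE PRINTS: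
# the Disegni–Gross–Zagier pair with the PIN THEOREM in place of the misstated all-`(V, p, d)` pin fact

Cell `bsd-print-cf2` (`run/shared/lean/pub/bsd-print-cf2/`), width seat `bsd-line-cf2-p1-w8` g27; deliverable (B2)
of the planner's SUMMON `wake/SUMMON-bsd-line-cf2-p1-w8-20260831T031655Z.md` («PIN THEOREM IN, MISSTATED PROP
OUT»). `--supports stmt-BirchSwinnertonDyer-20368` (helper). THEOREMS ONLY (no `def`, no named fact, no `sorry`);
every named fact appears as an ANTECEDENT of the statements (`thmB_chi_quadraticBaseChange`, `exists_isCanonicalCyc`,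
`hasEntireLFunction_rat`). BSD is not proved by any of this; no summit statement is claimed; 20368 is not closed here.

## What is proved, and why

The ticket twin `disegniGZ_pair_two_of_prints` (-w8 g25, p801334; = route-A support item stmt-27325 = Lines v3.5
`stub_disegniGZ_pair_two`) takes FOUR named facts as antecedents, the third being the literal all-`(V, p, d)` Prop
`WeierstrassCurve.isCanonicalCyc_pairing_eq_minusTwist`, which -w8 g26 showed MISSTATED (junk branches) while PROVING
its content in the frame's generality as `DisegniPairTwo.pairing_eq_minusTwist_pairing_of_pair` (p805565): at `p = 2`,
`d ∈ {−1, 2, −2}`, for `V` `ℤ`-integral with `V ⊗ ℚ₂` carrying a Mazur–Tate sigma-squared pair. A stub citing an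
unprovable Prop never closes; this file removes it from the ticket:

* §1 `disegniGZ_line_of_nine_prints` — ONE `ψ∘N`-line (primitive `ψ` mod `m ∣ 8`, `2 ∣ m`, `ψ(ℓ) = (d/ℓ)` at odd
  primes, `d ∈ {−1, 2, −2}`, twist parameter `e = d`), exactly as -w8 g25's `disegniGZ_line_of_prints` but composed
  through the POINTWISE-pin repackaging `thmB_chi_quadraticBaseChange.exists_datum_pinned_of_fixing_of_pinAt` (-w8 g27,
  `ChiLineTheoremBPinAtProofs.lean`) with `hPinAt :=` the PIN THEOREM; the price is ONE extra hypothesis per frame,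
  `∃ Sq c, (V.baseChange ℚ_[2]).IsMazurTateSigmaSqPair Sq c` (for the line's `V = W_k` it is
  `cm7Twist_exists_isMazurTateSigmaSqPair_two`), placed right after `IsOrdinaryAt V 2`; the instances
  `[V.IsIntegral ℤ]`, `[(V.baseChange ℚ_[2]).IsIntegral ℤ_[2]]` come from `[V.IsGloballyMinimal]`
  (`IsGloballyMinimal.isIntegral_int`, `isIntegral_padicInt_baseChange`). All other discharges as in g25's line
  (`ℓ ∣ m ⇒ ℓ² ∤ N`, not exceptional, (ε) simple zero, `χ(τ) = −1`, `x(Φ_t ι P) = X/e`).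
* §2 ★★★ `disegniGZ_pair_two_of_nine_prints` — the CONJUNCTION for `(χ₈, 2)`, `(χ₄, −1)`, `(χ₈′, −2)`: its TYPE is
  the text of stmt-27325 / `disegniGZ_pair_two_of_prints` with the antecedent
  `WeierstrassCurve.isCanonicalCyc_pairing_eq_minusTwist →` DELETED and, in each of the three `d`-blocks, the hypothesis
  `(∃ Sq : PowerSeries ℚ_[2], ∃ c : ℚ_[2], (V.baseChange ℚ_[2]).IsMazurTateSigmaSqPair Sq c) →` inserted after
  `Literature.NumberTheory.EllipticCurves.IsOrdinaryAt V 2 →` — NOTHING ELSE (whitespace-normalised one-line text: HOME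
  `bsd-line-cf2-p1-w8/stub_disegniGZ_pair_two_v36_NINE.txt`). The LEAD's v3.6 `stub_disegniGZ_pair_two` becomes a
  theorem reference to it; S0′ drops from ten named facts to nine.

References: D. Disegni, Compos. Math. 153 (2017), Thm. B, (1.1.3), (4.1.7) [Disegni2017]; B. Gross, MSRI Publ. 49
(2004) §3, §13 [Gross2004]; C. Breuil, B. Conrad, F. Diamond, R. Taylor, JAMS 14 (2001) Thm. A
[BreuilConradDiamondTaylor2001]; B. Mazur, W. Stein, J. Tate (2006) §2.7–2.8 [MazurSteinTate2006]; K. Ireland, M. Rosen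
(1990) Prop. 5.2.2 [IrelandRosen1990].
-/

set_option autoImplicit false
set_option linter.dupNamespace false

noncomputable section

open scoped Classical MatrixGroups ModularForm NumberField

open CongruenceSubgroup NumberField IsDedekindDomain WeierstrassCurve Literature.NumberTheory.EllipticCurves
  Literature.NumberTheory.EllipticCurves.ModularForms
  Literature.NumberTheory.EllipticCurves.Disegni2017 Literature.NumberTheory.GaloisRepresentations
  Summit.BirchSwinnertonDyer.Rank1Residual.AdditivePotMult

namespace Summit.BirchSwinnertonDyer.BirchSwinnertonDyer.Theorems.PrintCf2.DisegniPairTwo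

/-! ### §1 ONE line on nine prints: primitive `ψ` mod `m ∣ 8` with `ψ(ℓ) = (d/ℓ)`, `d ∈ {−1, 2, −2}` -/

section Line

/-- **One `ψ∘N`-line of the ticket from the TWO typed facts + modularity + a sigma-squared pair (the pin is
the theorem `pairing_eq_minusTwist_pairing_of_pair`).** For `ψ` a primitive Dirichlet character mod `m` with
`m ∣ 8`, `2 ∣ m` and `ψ(ℓ) = (d/ℓ)` at every odd prime `ℓ`, `d ∈ {−1, 2, −2}`, twist parameter `e = d ∈ ℚ`: there
is a universal `ρ ∈ ℤ` (`= v₂(c)`) such that for every frame of the item — with the ONE extra hypothesis that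
`V ⊗ ℚ₂` carries a Mazur–Tate sigma-squared pair — there is a `G`-invariant datum `DH` on `V(H)` with
`ChiLineGrossZagierClauses … (ψ∘N) … DH`, PINNED to every canonical minus-twist `ℚ`-datum `Dc` of `V^{(e)}` by
`DH(Φ_t P, Φ_t P) = r·Dc(P, P)`, `r ≠ 0`, `v₂(r) = ρ`. Same discharges as `disegniGZ_line_of_prints`; the pin by
`thmB_chi_quadraticBaseChange.exists_datum_pinned_of_fixing_of_pinAt` fed with `pairing_eq_minusTwist_pairing_of_pair`.
[cite: Disegni2017, Theorem B (arXiv v3 PDF p. 8 L9–18), (4.1.7)] [cite: MazurSteinTate2006, §2.7–2.8]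
[cite: Gross2004, §13] -/
theorem disegniGZ_line_of_nine_prints (hB : thmB_chi_quadraticBaseChange) (hE : exists_isCanonicalCyc)
    (hmod : hasEntireLFunction_rat)
    {m : ℕ} [NeZero m] (ξ : DirichletCharacter ℂ m) (hξ : ξ.IsPrimitive) (hm8 : m ∣ 8) (hm2 : 2 ∣ m)
    (d : ℤ) (hd : d = -1 ∨ d = 2 ∨ d = -2) (e : ℚ) (he : (d : ℚ) = e)
    (hξd : ∀ ℓ : ℕ, ℓ.Prime → ℓ ≠ 2 → ξ ℓ = (jacobiSym d ℓ : ℂ)) :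
    ∃ ρ : ℤ, ∀ (ι : PadicAlgCl 2 ≃+* ℂ) (K : Type) [Field K] [NumberField K] [IsGalois ℚ K],
    Literature.NumberTheory.EllipticCurves.IsImaginaryQuadratic K → ((Ideal.span {(2 : ℤ)}).primesOver
    (NumberField.RingOfIntegers K)).ncard = 2 → ∀ (𝔭 𝔭' : IsDedekindDomain.HeightOneSpectrum
    (NumberField.RingOfIntegers K)), ((2 : ℕ) : NumberField.RingOfIntegers K) ∈ 𝔭.asIdeal → ((2 : ℕ) :
    NumberField.RingOfIntegers K) ∈ 𝔭'.asIdeal → 𝔭 ≠ 𝔭' → ∀ (κ : DirichletCharacter ℂ (NumberField.discr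
    K).natAbs), (∀ ℓ : ℕ, ℓ.Prime → ℓ ≠ 2 → κ ℓ = (jacobiSym (NumberField.discr K) ℓ : ℂ)) → ∀ (V V' :
    WeierstrassCurve ℚ) [V.IsElliptic] [V.IsGloballyMinimal] [V'.IsElliptic] [V'.IsGloballyMinimal],
    Literature.NumberTheory.EllipticCurves.IsOrdinaryAt V 2 → (∃ Sq : PowerSeries ℚ_[2], ∃ c : ℚ_[2],
    (V.baseChange ℚ_[2]).IsMazurTateSigmaSqPair Sq c) → ∀ {N N' : ℕ} [NeZero N] [NeZero N'] (f : CuspForm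
    (CongruenceSubgroup.Gamma0 N) 2) (f' : CuspForm (CongruenceSubgroup.Gamma0 N') 2),
    Literature.NumberTheory.EllipticCurves.ModularForms.IsNewformOf V f →
    Literature.NumberTheory.EllipticCurves.ModularForms.IsNewformOf V' f' → (∀ n : ℕ,
    Literature.NumberTheory.EllipticCurves.ModularForms.cuspCoeff f' n = κ (n : ZMod _) *
    Literature.NumberTheory.EllipticCurves.ModularForms.cuspCoeff f n) → ∀ {M M' : ℕ} [NeZero M] [NeZero M'] (g
    : CuspForm (CongruenceSubgroup.Gamma0 M) 2) (g' : CuspForm (CongruenceSubgroup.Gamma0 M') 2) (W W' :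
    WeierstrassCurve ℚ) [W.IsElliptic] [W'.IsElliptic],
    Literature.NumberTheory.EllipticCurves.ModularForms.IsNewformOf W g →
    Literature.NumberTheory.EllipticCurves.ModularForms.IsNewformOf W' g' → (∀ m : ℕ,
    Literature.NumberTheory.EllipticCurves.ModularForms.cuspCoeff g m = (ξ) m *
    Literature.NumberTheory.EllipticCurves.ModularForms.cuspCoeff f m) → (∀ m : ℕ,
    Literature.NumberTheory.EllipticCurves.ModularForms.cuspCoeff g' m = (ξ) m *
    Literature.NumberTheory.EllipticCurves.ModularForms.cuspCoeff f' m) → W.analyticRank = 1 →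
    W'.entireLFunction 1 ≠ 0 → ∀ {H : Type} [Field H] [NumberField H] [Algebra K H] [(V.baseChange
    H).IsGloballyMinimal], Module.finrank K H = 2 → ∀ {t : H} (htK : t ∉ Set.range (algebraMap K H)) (ht2 : t ^
    2 = algebraMap ℚ H e) (htQ : t ∉ Set.range (algebraMap ℚ H)) (G : Subgroup (H ≃ₐ[ℚ] H)) (χ : G →* ℂˣ) (s : G
    → ℤ), (∀ σ, ((χ σ : ℂˣ) : ℂ) = (s σ : ℂ)) → (∀ (σ : G) (a : K), σ.1 (algebraMap K H a) = algebraMap K H a) →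
    ∀ (τ : H ≃ₐ[ℚ] H) (hτG : τ ∈ G), s ⟨τ, hτG⟩ = -1 → (∀ a : K, τ (algebraMap K H a) = algebraMap K H a) → τ t
    = -t → ∀ [(V.quadraticTwist e).IsElliptic], ∃ DH : WeierstrassCurve.PAdicHeightDataK V 2 H, (∀ (σ : G) (a b
    : (V.baseChange H).toAffine.Point), DH.pairing (Literature.NumberTheory.EllipticCurves.pointGalHom V H σ.1
    a) (Literature.NumberTheory.EllipticCurves.pointGalHom V H σ.1 b) = DH.pairing a b) ∧
    Literature.NumberTheory.EllipticCurves.Disegni2017.ChiLineGrossZagierClauses ι K V H f (ι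
    (((Literature.NumberTheory.EllipticCurves.unitRoot V 2 : ℚ_[2]) : PadicAlgCl 2)))
    (Literature.NumberTheory.EllipticCurves.Disegni2017.baseChangeDirichlet K (ξ)) 𝔭 𝔭' G χ DH ∧ ∃ r : ℚ, r ≠ 0
    ∧ padicValRat 2 r = ρ ∧ ∀ (Dc : WeierstrassCurve.PAdicHeightData (V.quadraticTwist e) 2),
    Dc.IsCanonicalSqMinusTwist → ∀ P : (V.quadraticTwist e).toAffine.Point, DH.pairing
    (Summit.BirchSwinnertonDyer.Rank1Residual.AdditivePotMult.twistPointEquivOver V (htQ) ht2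
    (WeierstrassCurve.QuadraticDescent.incl H (V.quadraticTwist e) P))
    (Summit.BirchSwinnertonDyer.Rank1Residual.AdditivePotMult.twistPointEquivOver V (htQ) ht2
    (WeierstrassCurve.QuadraticDescent.incl H (V.quadraticTwist e) P)) = (r : ℚ_[2]) * Dc.pairing P P := by
  subst he
  obtain ⟨c, hc, h⟩ := thmB_chi_quadraticBaseChange.exists_datum_pinned_of_fixing_of_pinAt hB hE (p := 2)
  refine ⟨padicValRat 2 c, ?_⟩
  intro ι K _ _ _ hK hsplit 𝔭 𝔭' h𝔭 h𝔭' hne κ hκ V V' _ _ _ _ hordV hpair N N' _ _ f f' hfV _hfV' hV' M M' _ _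
    g g' W W' _ _ hg hg' hgξ hg'ξ hW1 hL' H _ _ _ _ hKH t htK ht2 htQ G χ s hs hGK τ hτG hsτ hτK hτt _
  -- the quadratic field: `[K:ℚ] = 2`, `d_K ≡ 1 (8)`, `κ(2) = 1`, `(m, d_K) = 1`
  have h2K : Module.finrank ℚ K = 2 := hK.1
  have h81 : NumberField.discr K % 8 = 1 :=
    (Literature.NumberTheory.QuadraticFields.Quadratic.ncard_primesOver_two_eq_two_iff (K := K) h2K).mp
      hsplit
  obtain ⟨-, hκ2⟩ :=
    Literature.NumberTheory.QuadraticFields.kroneckerChar_two_of_ncard_primesOver_two h2K hsplit κ hκ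
  have hd2 : Nat.Coprime 2 (NumberField.discr K).natAbs := by
    rw [Nat.coprime_two_left, Int.natAbs_odd]
    exact Int.odd_iff.mpr (by omega)
  have hcop : Nat.Coprime m (NumberField.discr K).natAbs :=
    Nat.Coprime.coprime_dvd_left hm8 (by simpa using Nat.Coprime.pow_left 3 hd2)
  -- the fact's hypotheses on `ψ` and on the level
  have hψ : ∀ ℓ : ℕ, ℓ.Prime → ℓ ≠ 2 → ¬ ℓ ∣ m → ξ ℓ = (jacobiSym d ℓ : ℂ) :=
    fun ℓ hℓ hℓ2 _ => hξd ℓ hℓ hℓ2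
  have hmN : ∀ ℓ : ℕ, ℓ.Prime → ℓ ∣ m → ¬ ℓ ^ 2 ∣ N := by
    intro ℓ hℓ hℓm hℓN
    have hℓ8 : ℓ ∣ 2 ^ 3 := by simpa using dvd_trans hℓm hm8
    have hℓ2 : ℓ = 2 := (Nat.prime_dvd_prime_iff_eq hℓ Nat.prime_two).mp (hℓ.dvd_of_dvd_pow hℓ8)
    subst hℓ2
    have h2N : 2 ∣ N := dvd_trans (dvd_pow_self 2 two_ne_zero) hℓN
    have hbad := (hfV.dvd_level_iff_dvd_conductorNorm Nat.prime_two).mp h2N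
    exact (V.dvd_conductorNorm_iff_not_hasGoodReductionAtPrime 2).mp hbad hordV.1
  -- not exceptional at `𝔭`, `𝔭′` (`ψ∘N` ramified above `2`, `a ≠ 0`)
  have hα0 : (unitRoot V 2 : ℚ_[2]) ≠ 0 := (unitRoot_coe_spec (W := V) hordV).2.2
  have ha : ι (((unitRoot V 2 : ℚ_[2]) : PadicAlgCl 2)) ≠ 0 :=
    (map_ne_zero ι).mpr ((map_ne_zero (algebraMap ℚ_[2] (PadicAlgCl 2))).mpr hα0)
  have hexc : IsNotExceptionalAt (p := 2) (ι (((unitRoot V 2 : ℚ_[2]) : PadicAlgCl 2)))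
      (baseChangeDirichlet K ξ) 𝔭 := by
    rw [baseChangeDirichlet_def]
    exact isNotExceptionalAt_compRelNorm_ofDirichlet_of_split (p := 2) h2K hsplit hξ hm2 𝔭 h𝔭 ha
  have hexc' : IsNotExceptionalAt (p := 2) (ι (((unitRoot V 2 : ℚ_[2]) : PadicAlgCl 2)))
      (baseChangeDirichlet K ξ) 𝔭' := by
    rw [baseChangeDirichlet_def]
    exact isNotExceptionalAt_compRelNorm_ofDirichlet_of_split (p := 2) h2K hsplit hξ hm2 𝔭' h𝔭' ha
  -- (ε): simple central zero
  have hΛ := simpleZero_rankinSelberg_of_pair K hmod h2K κ hκ hκ2 hfV.1 hV' hξ hcop W W' hg hg' hgξ hg'ξ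
    hW1 hL'
  -- `χ(τ) = s(τ) = −1`
  have hχ : ((χ ⟨τ, hτG⟩ : ℂˣ) : ℂ) = -1 := by
    rw [hs, hsτ]
    norm_num
  -- THE PIN on the frame `(V, 2, d, H)`: the theorem `pairing_eq_minusTwist_pairing_of_pair` (-w8 g26)
  have hPinAt : ∀ (DH₀ : PAdicHeightDataK V 2 H) (Dc : PAdicHeightData (V.quadraticTwist (d : ℚ)) 2),
      DH₀.IsCanonicalCyc → Dc.IsCanonicalSqMinusTwist →
        ∀ {X Y : ℚ} (hP : (V.quadraticTwist (d : ℚ)).toAffine.Nonsingular X Y) {x' y' : H}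
          (hP' : (V.baseChange H).toAffine.Nonsingular x' y'),
          x' = algebraMap ℚ H (X / (d : ℚ)) →
            DH₀.pairing (.some x' y' hP') (.some x' y' hP') = Dc.pairing (.some X Y hP) (.some X Y hP) :=
    fun DH₀ Dc hcan hDc _ _ hP _ _ hP' hx' =>
      pairing_eq_minusTwist_pairing_of_pair V H hpair hd DH₀ Dc hcan hDc hP hP' hx'
  obtain ⟨DH, hinv, hGZ, hpin⟩ := h ι K 𝔭 𝔭' V f ξ d H t τ G χ hτG hPinAt hK hsplit h𝔭 h𝔭' hne hfV hordV
    hψ hmN hexc hexc' hΛ hKH ht2 htK hτK hτt hGK hχ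
  refine ⟨DH, fun σ a b => hinv σ.1 a b, hGZ, c, hc, rfl, fun Dc hDc P => ?_⟩
  rcases P with _ | ⟨X, Y, hP⟩
  · rw [← Affine.Point.zero_def]
    simp only [map_zero, mul_zero]
  · obtain ⟨yQ, hQ, hQeq⟩ := x_twistPointEquivOver_incl_some' V htQ ht2 hP
    rw [hQeq]
    refine hpin Dc hDc hP hQ ?_
    rw [inv_pow, ht2, ← map_inv₀, ← map_mul, ← div_eq_inv_mul]

end Line

/-! ### §2 ★★★ The ticket on nine prints: the three lines `(χ₈, 2)`, `(χ₄, −1)`, `(χ₈′, −2)` -/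

section Pair

/-- ★★★ **THE ENTRY TICKET ON NINE PRINTS** — the text of the route item `PrintCf2.SplitBadTwoDisegniGZPairOfFacts`
(stmt-BirchSwinnertonDyer-27325; = Lines v3.5 `stub_disegniGZ_pair_two`) with the antecedent
`WeierstrassCurve.isCanonicalCyc_pairing_eq_minusTwist →` DELETED (its content is the theorem
`pairing_eq_minusTwist_pairing_of_pair`, -w8 g26) and, inside each of the three `d`-blocks (`d = 2, −1, −2`), ONE
extra hypothesis `(∃ Sq : PowerSeries ℚ_[2], ∃ c : ℚ_[2], (V.baseChange ℚ_[2]).IsMazurTateSigmaSqPair Sq c) →` after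
`Literature.NumberTheory.EllipticCurves.IsOrdinaryAt V 2 →`; nothing else changes. From the typed facts
`thmB_chi_quadraticBaseChange`, `exists_isCanonicalCyc` and the modularity continuation `hasEntireLFunction_rat`, by
`disegniGZ_line_of_nine_prints` at `(χ₈, 8, 2)`, `(χ₄, 4, −1)`, `(χ₈′, 8, −2)` (Mathlib `jacobiSym.at_two / at_neg_one
/ at_neg_two`, tree `isPrimitive_χ₈/χ₄/χ₈'_ringHomComp`). Whitespace-normalised one-line text: HOME
`bsd-line-cf2-p1-w8/stub_disegniGZ_pair_two_v36_NINE.txt`.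
[cite: Disegni2017, Theorem A, Theorem B (arXiv v3 PDF pp. 6–8), (1.1.3), (4.1.7)] [cite: MazurSteinTate2006, §2.7–2.8]
[cite: Gross2004, §3, §13] [cite: BreuilConradDiamondTaylor2001, Thm. A] -/
theorem disegniGZ_pair_two_of_nine_prints :
    Literature.NumberTheory.EllipticCurves.Disegni2017.thmB_chi_quadraticBaseChange → WeierstrassCurve.exists_isCanonicalCyc → WeierstrassCurve.hasEntireLFunction_rat → ( (∃ ρ : ℤ, ∀ (ι : PadicAlgCl 2 ≃+* ℂ) (K : Type) [Field K] [NumberField K] [IsGalois ℚ K],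
    Literature.NumberTheory.EllipticCurves.IsImaginaryQuadratic K → ((Ideal.span {(2 : ℤ)}).primesOver
    (NumberField.RingOfIntegers K)).ncard = 2 → ∀ (𝔭 𝔭' : IsDedekindDomain.HeightOneSpectrum
    (NumberField.RingOfIntegers K)), ((2 : ℕ) : NumberField.RingOfIntegers K) ∈ 𝔭.asIdeal → ((2 : ℕ) :
    NumberField.RingOfIntegers K) ∈ 𝔭'.asIdeal → 𝔭 ≠ 𝔭' → ∀ (κ : DirichletCharacter ℂ (NumberField.discr
    K).natAbs), (∀ ℓ : ℕ, ℓ.Prime → ℓ ≠ 2 → κ ℓ = (jacobiSym (NumberField.discr K) ℓ : ℂ)) → ∀ (V V' :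
    WeierstrassCurve ℚ) [V.IsElliptic] [V.IsGloballyMinimal] [V'.IsElliptic] [V'.IsGloballyMinimal],
    Literature.NumberTheory.EllipticCurves.IsOrdinaryAt V 2 → (∃ Sq : PowerSeries ℚ_[2], ∃ c : ℚ_[2],
    (V.baseChange ℚ_[2]).IsMazurTateSigmaSqPair Sq c) → ∀ {N N' : ℕ} [NeZero N] [NeZero N'] (f :
    CuspForm (CongruenceSubgroup.Gamma0 N) 2) (f' : CuspForm (CongruenceSubgroup.Gamma0 N') 2),
    Literature.NumberTheory.EllipticCurves.ModularForms.IsNewformOf V f →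
    Literature.NumberTheory.EllipticCurves.ModularForms.IsNewformOf V' f' → (∀ n : ℕ,
    Literature.NumberTheory.EllipticCurves.ModularForms.cuspCoeff f' n = κ (n : ZMod _) *
    Literature.NumberTheory.EllipticCurves.ModularForms.cuspCoeff f n) → ∀ {M M' : ℕ} [NeZero M] [NeZero
    M'] (g : CuspForm (CongruenceSubgroup.Gamma0 M) 2) (g' : CuspForm (CongruenceSubgroup.Gamma0 M') 2) (W
    W' : WeierstrassCurve ℚ) [W.IsElliptic] [W'.IsElliptic],
    Literature.NumberTheory.EllipticCurves.ModularForms.IsNewformOf W g →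
    Literature.NumberTheory.EllipticCurves.ModularForms.IsNewformOf W' g' → (∀ m : ℕ,
    Literature.NumberTheory.EllipticCurves.ModularForms.cuspCoeff g m = (ZMod.χ₈.ringHomComp
    (Int.castRingHom ℂ)) m * Literature.NumberTheory.EllipticCurves.ModularForms.cuspCoeff f m) → (∀ m :
    ℕ, Literature.NumberTheory.EllipticCurves.ModularForms.cuspCoeff g' m = (ZMod.χ₈.ringHomComp
    (Int.castRingHom ℂ)) m * Literature.NumberTheory.EllipticCurves.ModularForms.cuspCoeff f' m) →
    W.analyticRank = 1 → W'.entireLFunction 1 ≠ 0 → ∀ {H : Type} [Field H] [NumberField H] [Algebra K H]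
    [(V.baseChange H).IsGloballyMinimal], Module.finrank K H = 2 → ∀ {t : H} (htK : t ∉ Set.range
    (algebraMap K H)) (ht2 : t ^ 2 = algebraMap ℚ H 2) (htQ : t ∉ Set.range (algebraMap ℚ H)) (G :
    Subgroup (H ≃ₐ[ℚ] H)) (χ : G →* ℂˣ) (s : G → ℤ), (∀ σ, ((χ σ : ℂˣ) : ℂ) = (s σ : ℂ)) → (∀ (σ : G) (a :
    K), σ.1 (algebraMap K H a) = algebraMap K H a) → ∀ (τ : H ≃ₐ[ℚ] H) (hτG : τ ∈ G), s ⟨τ, hτG⟩ = -1 → (∀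
    a : K, τ (algebraMap K H a) = algebraMap K H a) → τ t = -t → ∀ [(V.quadraticTwist 2).IsElliptic], ∃ DH
    : WeierstrassCurve.PAdicHeightDataK V 2 H, (∀ (σ : G) (a b : (V.baseChange H).toAffine.Point),
    DH.pairing (Literature.NumberTheory.EllipticCurves.pointGalHom V H σ.1 a)
    (Literature.NumberTheory.EllipticCurves.pointGalHom V H σ.1 b) = DH.pairing a b) ∧
    Literature.NumberTheory.EllipticCurves.Disegni2017.ChiLineGrossZagierClauses ι K V H f (ι
    (((Literature.NumberTheory.EllipticCurves.unitRoot V 2 : ℚ_[2]) : PadicAlgCl 2)))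
    (Literature.NumberTheory.EllipticCurves.Disegni2017.baseChangeDirichlet K (ZMod.χ₈.ringHomComp
    (Int.castRingHom ℂ))) 𝔭 𝔭' G χ DH ∧ ∃ r : ℚ, r ≠ 0 ∧ padicValRat 2 r = ρ ∧ ∀ (Dc :
    WeierstrassCurve.PAdicHeightData (V.quadraticTwist 2) 2), Dc.IsCanonicalSqMinusTwist → ∀ P :
    (V.quadraticTwist 2).toAffine.Point, DH.pairing
    (Summit.BirchSwinnertonDyer.Rank1Residual.AdditivePotMult.twistPointEquivOver V (htQ) ht2
    (WeierstrassCurve.QuadraticDescent.incl H (V.quadraticTwist 2) P))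
    (Summit.BirchSwinnertonDyer.Rank1Residual.AdditivePotMult.twistPointEquivOver V (htQ) ht2
    (WeierstrassCurve.QuadraticDescent.incl H (V.quadraticTwist 2) P)) = (r : ℚ_[2]) * Dc.pairing P P) ∧ (∃ ρ : ℤ, ∀ (ι : PadicAlgCl 2 ≃+* ℂ) (K : Type) [Field K] [NumberField K] [IsGalois ℚ K],
    Literature.NumberTheory.EllipticCurves.IsImaginaryQuadratic K → ((Ideal.span {(2 : ℤ)}).primesOver
    (NumberField.RingOfIntegers K)).ncard = 2 → ∀ (𝔭 𝔭' : IsDedekindDomain.HeightOneSpectrum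
    (NumberField.RingOfIntegers K)), ((2 : ℕ) : NumberField.RingOfIntegers K) ∈ 𝔭.asIdeal → ((2 : ℕ) :
    NumberField.RingOfIntegers K) ∈ 𝔭'.asIdeal → 𝔭 ≠ 𝔭' → ∀ (κ : DirichletCharacter ℂ (NumberField.discr
    K).natAbs), (∀ ℓ : ℕ, ℓ.Prime → ℓ ≠ 2 → κ ℓ = (jacobiSym (NumberField.discr K) ℓ : ℂ)) → ∀ (V V' :
    WeierstrassCurve ℚ) [V.IsElliptic] [V.IsGloballyMinimal] [V'.IsElliptic] [V'.IsGloballyMinimal],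
    Literature.NumberTheory.EllipticCurves.IsOrdinaryAt V 2 → (∃ Sq : PowerSeries ℚ_[2], ∃ c : ℚ_[2],
    (V.baseChange ℚ_[2]).IsMazurTateSigmaSqPair Sq c) → ∀ {N N' : ℕ} [NeZero N] [NeZero N'] (f :
    CuspForm (CongruenceSubgroup.Gamma0 N) 2) (f' : CuspForm (CongruenceSubgroup.Gamma0 N') 2),
    Literature.NumberTheory.EllipticCurves.ModularForms.IsNewformOf V f →
    Literature.NumberTheory.EllipticCurves.ModularForms.IsNewformOf V' f' → (∀ n : ℕ,
    Literature.NumberTheory.EllipticCurves.ModularForms.cuspCoeff f' n = κ (n : ZMod _) *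
    Literature.NumberTheory.EllipticCurves.ModularForms.cuspCoeff f n) → ∀ {M M' : ℕ} [NeZero M] [NeZero
    M'] (g : CuspForm (CongruenceSubgroup.Gamma0 M) 2) (g' : CuspForm (CongruenceSubgroup.Gamma0 M') 2) (W
    W' : WeierstrassCurve ℚ) [W.IsElliptic] [W'.IsElliptic],
    Literature.NumberTheory.EllipticCurves.ModularForms.IsNewformOf W g →
    Literature.NumberTheory.EllipticCurves.ModularForms.IsNewformOf W' g' → (∀ m : ℕ,
    Literature.NumberTheory.EllipticCurves.ModularForms.cuspCoeff g m = (ZMod.χ₄.ringHomComp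
    (Int.castRingHom ℂ)) m * Literature.NumberTheory.EllipticCurves.ModularForms.cuspCoeff f m) → (∀ m :
    ℕ, Literature.NumberTheory.EllipticCurves.ModularForms.cuspCoeff g' m = (ZMod.χ₄.ringHomComp
    (Int.castRingHom ℂ)) m * Literature.NumberTheory.EllipticCurves.ModularForms.cuspCoeff f' m) →
    W.analyticRank = 1 → W'.entireLFunction 1 ≠ 0 → ∀ {H : Type} [Field H] [NumberField H] [Algebra K H]
    [(V.baseChange H).IsGloballyMinimal], Module.finrank K H = 2 → ∀ {t : H} (htK : t ∉ Set.range
    (algebraMap K H)) (ht2 : t ^ 2 = algebraMap ℚ H (-1)) (htQ : t ∉ Set.range (algebraMap ℚ H)) (G :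
    Subgroup (H ≃ₐ[ℚ] H)) (χ : G →* ℂˣ) (s : G → ℤ), (∀ σ, ((χ σ : ℂˣ) : ℂ) = (s σ : ℂ)) → (∀ (σ : G) (a :
    K), σ.1 (algebraMap K H a) = algebraMap K H a) → ∀ (τ : H ≃ₐ[ℚ] H) (hτG : τ ∈ G), s ⟨τ, hτG⟩ = -1 → (∀
    a : K, τ (algebraMap K H a) = algebraMap K H a) → τ t = -t → ∀ [(V.quadraticTwist (-1)).IsElliptic], ∃
    DH : WeierstrassCurve.PAdicHeightDataK V 2 H, (∀ (σ : G) (a b : (V.baseChange H).toAffine.Point),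
    DH.pairing (Literature.NumberTheory.EllipticCurves.pointGalHom V H σ.1 a)
    (Literature.NumberTheory.EllipticCurves.pointGalHom V H σ.1 b) = DH.pairing a b) ∧
    Literature.NumberTheory.EllipticCurves.Disegni2017.ChiLineGrossZagierClauses ι K V H f (ι
    (((Literature.NumberTheory.EllipticCurves.unitRoot V 2 : ℚ_[2]) : PadicAlgCl 2)))
    (Literature.NumberTheory.EllipticCurves.Disegni2017.baseChangeDirichlet K (ZMod.χ₄.ringHomComp
    (Int.castRingHom ℂ))) 𝔭 𝔭' G χ DH ∧ ∃ r : ℚ, r ≠ 0 ∧ padicValRat 2 r = ρ ∧ ∀ (Dc :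
    WeierstrassCurve.PAdicHeightData (V.quadraticTwist (-1)) 2), Dc.IsCanonicalSqMinusTwist → ∀ P :
    (V.quadraticTwist (-1)).toAffine.Point, DH.pairing
    (Summit.BirchSwinnertonDyer.Rank1Residual.AdditivePotMult.twistPointEquivOver V (htQ) ht2
    (WeierstrassCurve.QuadraticDescent.incl H (V.quadraticTwist (-1)) P))
    (Summit.BirchSwinnertonDyer.Rank1Residual.AdditivePotMult.twistPointEquivOver V (htQ) ht2
    (WeierstrassCurve.QuadraticDescent.incl H (V.quadraticTwist (-1)) P)) = (r : ℚ_[2]) * Dc.pairing P P) ∧ (∃ ρ : ℤ, ∀ (ι : PadicAlgCl 2 ≃+* ℂ) (K : Type) [Field K] [NumberField K] [IsGalois ℚ K],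
    Literature.NumberTheory.EllipticCurves.IsImaginaryQuadratic K → ((Ideal.span {(2 : ℤ)}).primesOver
    (NumberField.RingOfIntegers K)).ncard = 2 → ∀ (𝔭 𝔭' : IsDedekindDomain.HeightOneSpectrum
    (NumberField.RingOfIntegers K)), ((2 : ℕ) : NumberField.RingOfIntegers K) ∈ 𝔭.asIdeal → ((2 : ℕ) :
    NumberField.RingOfIntegers K) ∈ 𝔭'.asIdeal → 𝔭 ≠ 𝔭' → ∀ (κ : DirichletCharacter ℂ (NumberField.discr
    K).natAbs), (∀ ℓ : ℕ, ℓ.Prime → ℓ ≠ 2 → κ ℓ = (jacobiSym (NumberField.discr K) ℓ : ℂ)) → ∀ (V V' :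
    WeierstrassCurve ℚ) [V.IsElliptic] [V.IsGloballyMinimal] [V'.IsElliptic] [V'.IsGloballyMinimal],
    Literature.NumberTheory.EllipticCurves.IsOrdinaryAt V 2 → (∃ Sq : PowerSeries ℚ_[2], ∃ c : ℚ_[2],
    (V.baseChange ℚ_[2]).IsMazurTateSigmaSqPair Sq c) → ∀ {N N' : ℕ} [NeZero N] [NeZero N'] (f :
    CuspForm (CongruenceSubgroup.Gamma0 N) 2) (f' : CuspForm (CongruenceSubgroup.Gamma0 N') 2),
    Literature.NumberTheory.EllipticCurves.ModularForms.IsNewformOf V f →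
    Literature.NumberTheory.EllipticCurves.ModularForms.IsNewformOf V' f' → (∀ n : ℕ,
    Literature.NumberTheory.EllipticCurves.ModularForms.cuspCoeff f' n = κ (n : ZMod _) *
    Literature.NumberTheory.EllipticCurves.ModularForms.cuspCoeff f n) → ∀ {M M' : ℕ} [NeZero M] [NeZero
    M'] (g : CuspForm (CongruenceSubgroup.Gamma0 M) 2) (g' : CuspForm (CongruenceSubgroup.Gamma0 M') 2) (W
    W' : WeierstrassCurve ℚ) [W.IsElliptic] [W'.IsElliptic],
    Literature.NumberTheory.EllipticCurves.ModularForms.IsNewformOf W g →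
    Literature.NumberTheory.EllipticCurves.ModularForms.IsNewformOf W' g' → (∀ m : ℕ,
    Literature.NumberTheory.EllipticCurves.ModularForms.cuspCoeff g m = (ZMod.χ₈'.ringHomComp
    (Int.castRingHom ℂ)) m * Literature.NumberTheory.EllipticCurves.ModularForms.cuspCoeff f m) → (∀ m :
    ℕ, Literature.NumberTheory.EllipticCurves.ModularForms.cuspCoeff g' m = (ZMod.χ₈'.ringHomComp
    (Int.castRingHom ℂ)) m * Literature.NumberTheory.EllipticCurves.ModularForms.cuspCoeff f' m) →
    W.analyticRank = 1 → W'.entireLFunction 1 ≠ 0 → ∀ {H : Type} [Field H] [NumberField H] [Algebra K H]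
    [(V.baseChange H).IsGloballyMinimal], Module.finrank K H = 2 → ∀ {t : H} (htK : t ∉ Set.range
    (algebraMap K H)) (ht2 : t ^ 2 = algebraMap ℚ H (-2)) (htQ : t ∉ Set.range (algebraMap ℚ H)) (G :
    Subgroup (H ≃ₐ[ℚ] H)) (χ : G →* ℂˣ) (s : G → ℤ), (∀ σ, ((χ σ : ℂˣ) : ℂ) = (s σ : ℂ)) → (∀ (σ : G) (a :
    K), σ.1 (algebraMap K H a) = algebraMap K H a) → ∀ (τ : H ≃ₐ[ℚ] H) (hτG : τ ∈ G), s ⟨τ, hτG⟩ = -1 → (∀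
    a : K, τ (algebraMap K H a) = algebraMap K H a) → τ t = -t → ∀ [(V.quadraticTwist (-2)).IsElliptic], ∃
    DH : WeierstrassCurve.PAdicHeightDataK V 2 H, (∀ (σ : G) (a b : (V.baseChange H).toAffine.Point),
    DH.pairing (Literature.NumberTheory.EllipticCurves.pointGalHom V H σ.1 a)
    (Literature.NumberTheory.EllipticCurves.pointGalHom V H σ.1 b) = DH.pairing a b) ∧
    Literature.NumberTheory.EllipticCurves.Disegni2017.ChiLineGrossZagierClauses ι K V H f (ι
    (((Literature.NumberTheory.EllipticCurves.unitRoot V 2 : ℚ_[2]) : PadicAlgCl 2)))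
    (Literature.NumberTheory.EllipticCurves.Disegni2017.baseChangeDirichlet K (ZMod.χ₈'.ringHomComp
    (Int.castRingHom ℂ))) 𝔭 𝔭' G χ DH ∧ ∃ r : ℚ, r ≠ 0 ∧ padicValRat 2 r = ρ ∧ ∀ (Dc :
    WeierstrassCurve.PAdicHeightData (V.quadraticTwist (-2)) 2), Dc.IsCanonicalSqMinusTwist → ∀ P :
    (V.quadraticTwist (-2)).toAffine.Point, DH.pairing
    (Summit.BirchSwinnertonDyer.Rank1Residual.AdditivePotMult.twistPointEquivOver V (htQ) ht2
    (WeierstrassCurve.QuadraticDescent.incl H (V.quadraticTwist (-2)) P))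
    (Summit.BirchSwinnertonDyer.Rank1Residual.AdditivePotMult.twistPointEquivOver V (htQ) ht2
    (WeierstrassCurve.QuadraticDescent.incl H (V.quadraticTwist (-2)) P)) = (r : ℚ_[2]) * Dc.pairing P P) ) := by
  intro hB hE hmod
  exact ⟨disegniGZ_line_of_nine_prints hB hE hmod (ZMod.χ₈.ringHomComp (Int.castRingHom ℂ))
      isPrimitive_χ₈_ringHomComp dvd_rfl ⟨4, rfl⟩ 2 (by norm_num) 2 (by norm_num) χ₈_ringHomComp_eq_jacobiSym,
    disegniGZ_line_of_nine_prints hB hE hmod (ZMod.χ₄.ringHomComp (Int.castRingHom ℂ))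
      isPrimitive_χ₄_ringHomComp ⟨2, rfl⟩ ⟨2, rfl⟩ (-1) (by norm_num) (-1) (by norm_num)
      χ₄_ringHomComp_eq_jacobiSym,
    disegniGZ_line_of_nine_prints hB hE hmod (ZMod.χ₈'.ringHomComp (Int.castRingHom ℂ))
      isPrimitive_χ₈'_ringHomComp dvd_rfl ⟨4, rfl⟩ (-2) (by norm_num) (-2) (by norm_num)
      χ₈'_ringHomComp_eq_jacobiSym⟩

end Pair

end Summit.BirchSwinnertonDyer.BirchSwinnertonDyer.Theorems.PrintCf2.DisegniPairTwo

end
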